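import Summits.BirchSwinnertonDyer.BirchSwinnertonDyer.Theses.PAdicOrderV2

/-!
# Disproof of `PAdicOrderComparisonR2` (stmt-BirchSwinnertonDyer-0489) — findings

Standing disprover's work file (refuter-cdisprove-stmt-BirchSwinnertonDyer-0489-0, cycle 1).
Crux: `∀ W [IsElliptic] [IsGloballyMinimal] p [Fact p.Prime], IsOrdinaryAt W p → ∀ {N} [NeZero N]
(f : CuspForm (Gamma0 N) 2), IsNewformOf W f → (padicLFunction f (unitRoot W p)).order = W.analyticRank`.

VERDICT (cycle 1): NO KILL. Why it resists:
* Lean level — every instance of the hypotheses needs `IsNewformOf W f` for a CONCRETE curve, i.e.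
  modularity of one elliptic curve (`exists_isNewformOf` is cite-only); both sides of the conclusion
  (`PowerSeries.order` of a `limUnder` of Riemann sums; `analyticOrderNatAt` of a chosen entire
  continuation) have no evaluation path. The only junk levers of the definitions are closed below:
  `padicLFunction 0 α = 0` (§1, so the `f = 0` instance would falsify the conclusion — but `f = 0` is
  exactly what `IsNewformOf` excludes, `not_isNewformOf_zero`), and `unitRoot W p = 0 ⇒ L_p := 0`
  (§1–2, junk only OFF the ordinary locus, `unitRoot_eq_zero_of_dvd_frobeniusTrace`).
* Paper level — the statement is MTT86 §II.10 / Delbourgo2008 Conj. 2.3(i) ∧ classical BSD-rank: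
  `r_an = 0 ⇔ ord = 0` (interpolation, in tree: `stub_constantCoeff_eq_zero_iff`), parity (in tree:
  `stub_even_order_iff_even_analyticRank`, also `p = 2`), `rank ≤ ord` for odd `p` (Kato). A
  counterexample at a good ordinary `(E, p)` is EXACT vanishing of the canonical cyclotomic `p`-adic
  regulator (Schneider-degenerate pair) or `corank Sel_{p^∞} > r_an`; neither is certifiable by finite
  `p`-adic precision, none is known or expected (Schneider 1982/85 conjecture; Bertrand 1982 for CM rank 1).
* The ONE certifiable window is a LOW order: `ord_T L_p < r_an` with the low coefficient provably
  nonzero. For odd `p` Kato forbids it whenever `rank = r_an`; at `p = 2` (admitted by the crux, no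
  Kato/IMC in print) interpolation + parity leave `ord ∈ {1, 3, 5, …}` when `r_an = 3`. NUMERICS OF
  THIS CYCLE (jobs j016570, j017114, j017357; PARI/gp 2.15 `ellpadicbsd`, `r` = certified upper bound
  of `ord_T L_p`; table `results_rank3_padic.txt` attached to the item): box `a₁,a₃ ∈ {0,1}`,
  `a₂ ∈ {-1,0,1}`, `|a₄| ≤ 120`, `|a₆| ≤ 400` → 2 316 423 curves → 32 analytic-rank-3 isogeny
  classes with `5077 ≤ N ≤ 30000`; 24 good-ordinary pairs computed (`p = 2`: 9, `3`: 4, `5`: 7,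
  `7`: 2, `11`: 1, `13`: 1; levels `pN ≳ 9·10⁴` exceed a 24–40 GB PARI stack): `r = 3` in ALL 24,
  0 anomalies. The `p = 2` WINDOW IS EXHAUSTED for `N ≤ 30000`: all 9 rank-3 classes with good
  ordinary reduction at 2 (11197a, 18097a, 21443a, 22481a, 24301a, 25451a, 25751a, 26743a, 27773a;
  `a_2 = -1` each) give `r = 3` — the third `s`-derivative of `L_2(E, ·)` is certified nonzero and
  the lower ones vanish to `O(2^13)`; consistent with the crux (numerical, PARI OMS, not a Lean
  certificate). Rank 3 was outside every earlier sweep (rank ≤ 2: refute-pool-3 Sage 1047 pairs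
  p ≥ 5; j015320 PARI 75 pairs p = 3, 3 pairs p = 2: 0 anomalies).
* `p = 2` conventions of the tree's construction are the standard ones (§3: `γ = 5`, torsion `{±1}`),
  so a `p = 2` failure would be class MISSTATED (route kill criterion (c), repair `5 ≤ p →`/`p ≠ 2 →`).

Contents
* §1 junk values of the definitions (`padicLFunction_zero_form`, `padicLFunction_zero_root`,
  `unitRoot_eq_zero_of_dvd_frobeniusTrace`, `not_isNewformOf_zero`);
* §2 load-bearing hypotheses: `WithoutIsNewformOf` REFUTED (`false_without_isNewformOf`, witness
  `f = 0` on any ordinary `(W, p)`, which exist: `exists_isOrdinaryAt`); `WithoutIsOrdinaryAt` refuted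
  MODULO one modular curve with a supersingular/anomalous-divisible prime
  (`false_without_isOrdinaryAt_of`); `[W.IsGloballyMinimal]`, `[Fact p.Prime]`, `[NeZero N]` are not
  droppable (they type `unitRoot`/`IsOrdinaryAt`/`IsNewformOf`); `[W.IsElliptic]` is REDUNDANT: implied by
  `IsOrdinaryAt` (good reduction ⇒ Δ ≠ 0; `isElliptic_of_isOrdinaryAt`, proved);
* §3 `p = 2` conventions;
* §4 line `Sketch` (lead prover-line-stmt-BirchSwinnertonDyer-0489-0): joint sufficiency of the 5 stubs
  re-verified (`Lines/Sketch.lean`, rc 0); S1, S2 are LANDED tree theorems; S3–S5 are literal weakenings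
  of the crux (`stubs_of_crux`), so no stub can be false unless the crux is — the disprover has no
  stub-level target cheaper than the crux itself; S3–S5 at `p = 2` have no printed input at all.

LANDED (importable): `Summits.BirchSwinnertonDyer.BirchSwinnertonDyer.Theorems.PAdicOrderComparisonR2.
Negative.FalseWithoutIsNewformOf` (p98724, accepted 2026-08-16): the §1–§2 lemmas under the names
`Summit.BirchSwinnertonDyer.BirchSwinnertonDyer.Theorems.pAdicOrderComparisonR2_*`
(`_padicLFunction_zero_form`, `_padicLFunction_zero_root`, `_unitRoot_eq_zero_of_dvd_frobeniusTrace`,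
`_not_isNewformOf_zero`, `_exists_isOrdinaryAt`, `_false_without_isNewformOf`,
`_false_without_isOrdinaryAt_of`).

NEXT REGIMES (if re-armed): (i) `p = 3` for the ~15 remaining rank-3 classes with `3 ∤ N` (level
`3N ≤ 9·10⁴`, ~30 GB); (ii) the `p = 2` window for rank-3 classes with `3·10⁴ < N ≤ 6·10⁴` (level
`2N`, ≥ 60 GB stack) and for rank ≥ 4 (smallest conductor 234446 is even — bad at 2 — so the first
2-ordinary rank-4 class must be searched for); (iii) any stub the lead marks STUCK becomes a `-- Targets`
entry here; (iv) a FLAG-HIGH (`r > r_an` to precision) anywhere would be the first Schneider-degeneracy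
candidate in print and should be escalated (higher precision, independent Sage OMS run), though it can
never be certified by finite precision.
-/

set_option linter.dupNamespace false

namespace Summit.BirchSwinnertonDyer.BirchSwinnertonDyer.Cruxes.PAdicOrderComparisonR2.Disproof

open scoped MatrixGroups ModularForm
open Filter Topology CongruenceSubgroup
open Literature.NumberTheory.EllipticCurves Literature.NumberTheory.EllipticCurves.ModularForms
open Summit.BirchSwinnertonDyer.BirchSwinnertonDyer.Theses.PAdicOrderV2

/-! ## §1 Junk values of the definitions -/

section JunkValues

variable {N : ℕ} {p : ℕ} [Fact p.Prime]

/-- The modular symbol of the zero form vanishes. [folklore] -/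
theorem modularSymbol_zero_form (r : ℚ) : modularSymbol (0 : CuspForm (Gamma0 N) 2) r = 0 := by
  simp [modularSymbol]

/-- The plus symbol of the zero form vanishes. [folklore] -/
theorem plusSymbol_zero_form (r : ℚ) : plusSymbol (0 : CuspForm (Gamma0 N) 2) r = 0 := by
  simp [plusSymbol, modularSymbol_zero_form]

/-- The normalised plus symbol of the zero form vanishes (`0 / Ω⁺`). [folklore] -/
theorem normalizedPlusSymbol_zero_form (r : ℚ) :
    normalizedPlusSymbol (0 : CuspForm (Gamma0 N) 2) r = 0 := by
  simp [normalizedPlusSymbol, plusSymbol_zero_form]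

/-- The rational plus symbol of the zero form vanishes. [folklore] -/
theorem ratPlusSymbol_zero_form (r : ℚ) : ratPlusSymbol (0 : CuspForm (Gamma0 N) 2) r = 0 := by
  unfold ratPlusSymbol
  have h : ∃ q : ℚ, (q : ℝ) = normalizedPlusSymbol (0 : CuspForm (Gamma0 N) 2) r :=
    ⟨0, by simp [normalizedPlusSymbol_zero_form]⟩
  rw [dif_pos h]
  have h2 : ((h.choose : ℚ) : ℝ) = 0 := h.choose_spec.trans (normalizedPlusSymbol_zero_form r)
  exact_mod_cast h2

/-- The Mazur–Swinnerton-Dyer measure of the zero form is zero. [folklore] -/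
theorem msdMeasure_zero_form (α : ℚ_[p]) (n : ℕ) (a : ZMod (p ^ n)) :
    msdMeasure (0 : CuspForm (Gamma0 N) 2) α n a = 0 := by
  cases n <;> simp [msdMeasure, ratPlusSymbol_zero_form]

/-- The Riemann sums of the zero form vanish. [folklore] -/
theorem padicLRiemannSum_zero_form (α : ℚ_[p]) (k n : ℕ) :
    padicLRiemannSum (0 : CuspForm (Gamma0 N) 2) α k n = 0 := by
  simp [padicLRiemannSum, msdMeasure_zero_form]

/-- The coefficients of `L_p(0, α, T)` vanish (`limUnder` of the constant sequence `0`). [folklore] -/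
theorem padicLCoeff_zero_form (α : ℚ_[p]) (k : ℕ) :
    padicLCoeff (0 : CuspForm (Gamma0 N) 2) α k = 0 := by
  unfold padicLCoeff
  have : padicLRiemannSum (0 : CuspForm (Gamma0 N) 2) α k = fun _ => 0 :=
    funext (padicLRiemannSum_zero_form α k)
  rw [this]
  exact tendsto_const_nhds.limUnder_eq

/-- **Junk lever 1 (closed by `IsNewformOf`)**: the `p`-adic `L`-function of the ZERO cusp form is
the zero power series, for every `α`; its `T`-order is `⊤ ≠ ↑r_an`. [folklore] -/
theorem padicLFunction_zero_form (α : ℚ_[p]) :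
    padicLFunction (0 : CuspForm (Gamma0 N) 2) α = 0 := by
  ext k
  simp [padicLCoeff_zero_form]

/-- At the junk root `α = 0` the measure vanishes at every level `m ≥ 1` (`0⁻¹ = 0`). [folklore] -/
theorem msdMeasure_zero_root (f : CuspForm (Gamma0 N) 2) {m : ℕ} (hm : m ≠ 0) (a : ZMod (p ^ m)) :
    msdMeasure f (0 : ℚ_[p]) m a = 0 := by
  obtain ⟨n, rfl⟩ := Nat.exists_eq_succ_of_ne_zero hm
  simp [msdMeasure]

omit [Fact p.Prime] in
/-- `1 ≤ e₀` (`e₀ = 1` for odd `p`, `2` for `p = 2`). [folklore] -/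
theorem one_le_cyclotomicExponent : 1 ≤ cyclotomicExponent p := by
  unfold cyclotomicExponent
  split_ifs <;> norm_num

/-- At the junk root `α = 0` every Riemann sum vanishes (they live at level `n + e₀ ≥ 1`). [folklore] -/
theorem padicLRiemannSum_zero_root (f : CuspForm (Gamma0 N) 2) (k n : ℕ) :
    padicLRiemannSum f (0 : ℚ_[p]) k n = 0 := by
  have hm : n + cyclotomicExponent p ≠ 0 := by
    have := one_le_cyclotomicExponent (p := p); omega
  simp [padicLRiemannSum, msdMeasure_zero_root f hm]

/-- **Junk lever 2 (closed by `IsOrdinaryAt` + Hensel)**: `L_p(f, 0, T) = 0` for EVERY `f`: at the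
junk value `unitRoot W p = 0` (no unique unit root) the tree's `L_p(E, T)` is the zero series, of
`T`-order `⊤`. So the crux silently contains "`unitRoot W p ≠ 0` at every good ordinary `p`"
(Hensel; tree theorem `unitRoot_spec_holds`, `PAdicLFunctionProofs`). [folklore] -/
theorem padicLFunction_zero_root (f : CuspForm (Gamma0 N) 2) :
    padicLFunction f (0 : ℚ_[p]) = 0 := by
  ext k
  simp only [coeff_padicLFunction, map_zero]
  unfold padicLCoeff
  have : padicLRiemannSum f (0 : ℚ_[p]) k = fun _ => 0 := funext (padicLRiemannSum_zero_root f k)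
  rw [this]
  exact tendsto_const_nhds.limUnder_eq

/-- **Where lever 2 bites**: if `p ∣ a_p(W)` (supersingular `p ≥ 5`; also `a_p = 0, ±p`-type
cases at `p = 2, 3`, and every ADDITIVE bad prime, `a_p = 0`) then `X² - a_p X + p` has no unit
root in `ℤ_p` (a unit root `u` would give `‖u²‖ = 1` but `‖a_p u - p‖ < 1`), so `unitRoot W p = 0`.
[folklore] -/
theorem unitRoot_eq_zero_of_dvd_frobeniusTrace (W : WeierstrassCurve ℚ) [W.IsGloballyMinimal]
    (p : ℕ) [Fact p.Prime] (hdvd : (p : ℤ) ∣ W.frobeniusTrace p) : unitRoot W p = 0 := by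
  classical
  unfold unitRoot
  rw [dif_neg]
  rintro ⟨α, ⟨hα, hu⟩, -⟩
  have hαn : ‖α‖ = 1 := PadicInt.isUnit_iff.mp hu
  have ha : ‖(W.frobeniusTrace p : ℤ_[p])‖ < 1 := (PadicInt.norm_int_lt_one_iff_dvd _).mpr hdvd
  have hp : ‖(p : ℤ_[p])‖ < 1 := by
    rw [PadicInt.norm_p]
    exact inv_lt_one_of_one_lt₀ (by exact_mod_cast (Fact.out : p.Prime).one_lt)
  have heq : α ^ 2 = (W.frobeniusTrace p : ℤ_[p]) * α + -(p : ℤ_[p]) := by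
    linear_combination hα
  have h1 : ‖α ^ 2‖ = 1 := by rw [norm_pow, hαn, one_pow]
  have h2 : ‖(W.frobeniusTrace p : ℤ_[p]) * α + -(p : ℤ_[p])‖ < 1 := by
    refine lt_of_le_of_lt (PadicInt.nonarchimedean _ _) (max_lt ?_ ?_)
    · rw [norm_mul, hαn, mul_one]; exact ha
    · rw [norm_neg]; exact hp
  rw [← heq, h1] at h2
  exact lt_irrefl _ h2

/-- **Lever 1 is exactly excluded by the hypothesis**: the zero form is not the newform of any
curve (`IsNewform0` asks `a₁ = 1`, and the `q`-expansion of `0` is `0`). [folklore] -/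
theorem not_isNewformOf_zero [NeZero N] (W : WeierstrassCurve ℚ) :
    ¬ IsNewformOf W (0 : CuspForm (Gamma0 N) 2) := by
  rintro ⟨⟨-, -, hnorm⟩, -⟩
  unfold IsNormalized at hnorm
  have h0 : (⇑(0 : CuspForm (Gamma0 N) 2) : UpperHalfPlane → ℂ) = 0 := rfl
  rw [h0, UpperHalfPlane.qExpansion_zero, map_zero] at hnorm
  exact zero_ne_one hnorm

end JunkValues

/-! ## §2 Load-bearing hypotheses -/

section LoadBearing

/-- The crux with the hypothesis `IsNewformOf W f` DROPPED (any cusp form `f` of any level). -/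
def WithoutIsNewformOf : Prop :=
  ∀ (W : WeierstrassCurve ℚ) [W.IsElliptic] [W.IsGloballyMinimal] (p : ℕ) [Fact p.Prime],
    IsOrdinaryAt W p → ∀ {N : ℕ} [NeZero N] (f : CuspForm (Gamma0 N) 2),
      (padicLFunction f (unitRoot W p : ℚ_[p])).order = W.analyticRank

/-- The crux with the hypothesis `IsOrdinaryAt W p` DROPPED (any prime `p`). -/
def WithoutIsOrdinaryAt : Prop :=
  ∀ (W : WeierstrassCurve ℚ) [W.IsElliptic] [W.IsGloballyMinimal] (p : ℕ) [Fact p.Prime],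
    ∀ {N : ℕ} [NeZero N] (f : CuspForm (Gamma0 N) 2), IsNewformOf W f →
      (padicLFunction f (unitRoot W p : ℚ_[p])).order = W.analyticRank

/-- The curve `y² + y = x³ - x` (Cremona 37a1, `Δ = 37`), an explicit elliptic curve over `ℚ`. -/
def E37 : WeierstrassCurve ℚ := ⟨0, 0, 1, -1, 0⟩

instance isElliptic_E37 : E37.IsElliptic := ⟨by
  rw [isUnit_iff_ne_zero]
  simp only [E37, WeierstrassCurve.Δ, WeierstrassCurve.b₂, WeierstrassCurve.b₄, WeierstrassCurve.b₆,
    WeierstrassCurve.b₈]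
  norm_num⟩

/-- **Non-vacuity of the `(W, p)`-part of the hypotheses, in Lean**: there is a globally minimal
elliptic `W / ℚ` with a good ordinary prime (a global minimal model of 37a1,
`hasGlobalMinimalModel_rat_holds`, and `exists_good_ordinary_prime_holds`, Serre 1981 §8 — both
PROVED tree theorems, axioms `propext/Classical.choice/Quot.sound`). [folklore] -/
theorem exists_isOrdinaryAt :
    ∃ (W : WeierstrassCurve ℚ) (_ : W.IsElliptic) (_ : W.IsGloballyMinimal) (p : ℕ) (_ : Fact p.Prime),
      5 ≤ p ∧ IsOrdinaryAt W p := by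
  obtain ⟨C, hC⟩ := WeierstrassCurve.hasGlobalMinimalModel_rat_holds E37
  obtain ⟨p, hp, h5, hgood, hap⟩ := WeierstrassCurve.exists_good_ordinary_prime_holds (C • E37)
  exact ⟨C • E37, inferInstance, hC, p, hp, h5, hgood, hap⟩

/-- **`IsNewformOf` is load-bearing (REFUTATION of the weakened crux)**: without it, take any
ordinary `(W, p)` (`exists_isOrdinaryAt`) and `f = 0 ∈ S₂(Γ₀(1))`: `L_p(0, α, T) = 0` has `T`-order
`⊤ ≠ ↑r_an(W)`. Any proof of the crux must use the newform hypothesis beyond typing — at the very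
least its consequence `L_p(E, T) ≠ 0` (Rohrlich; tree theorem `padicLFunction_ne_zero_holds`).
[folklore] -/
theorem false_without_isNewformOf : ¬ WithoutIsNewformOf := by
  intro h
  obtain ⟨W, _, _, p, _, -, hord⟩ := exists_isOrdinaryAt
  have h1 := h W p hord (N := 1) (0 : CuspForm (Gamma0 1) 2)
  rw [padicLFunction_zero_form, PowerSeries.order_zero] at h1
  exact ENat.coe_ne_top _ h1.symm

/-- **`IsOrdinaryAt` is load-bearing, modulo one modular curve with a non-ordinary prime**: if some
globally minimal elliptic `W / ℚ` has a newform `f` (modularity of ONE curve — not constructible in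
the tree: `exists_isNewformOf` is cite-only) and a prime `p ∣ a_p(W)` (e.g. 11a1 at `p = 2`,
`a_2 = -2`; every curve has infinitely many supersingular primes, Elkies 1987), then the crux without
`IsOrdinaryAt` is false there: `unitRoot W p = 0` (`unitRoot_eq_zero_of_dvd_frobeniusTrace`), so the
tree's `L_p` is the zero series (`padicLFunction_zero_root`), of order `⊤ ≠ ↑r_an`. So ordinarity
enters any proof at least through Hensel (`unitRoot ≠ 0`), as expected. [folklore] -/
theorem false_without_isOrdinaryAt_of
    (hex : ∃ (W : WeierstrassCurve ℚ) (_ : W.IsElliptic) (_ : W.IsGloballyMinimal) (p : ℕ)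
      (_ : Fact p.Prime) (N : ℕ) (_ : NeZero N) (f : CuspForm (Gamma0 N) 2),
      IsNewformOf W f ∧ (p : ℤ) ∣ W.frobeniusTrace p) :
    ¬ WithoutIsOrdinaryAt := by
  intro h
  obtain ⟨W, _, _, p, _, N, _, f, hf, hdvd⟩ := hex
  have h1 := h W p f hf
  rw [unitRoot_eq_zero_of_dvd_frobeniusTrace W p hdvd, PadicInt.coe_zero, padicLFunction_zero_root,
    PowerSeries.order_zero] at h1
  exact ENat.coe_ne_top _ h1.symm

/-- **`[W.IsElliptic]` is a REDUNDANT binder of the crux** (information for the provers): good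
reduction at one prime already forces `Δ(W) ≠ 0` — the `ℤ_p`-minimal model of `W / ℚ_p` is
`C • W` with `Δ(C • W) = u⁻¹² Δ(W)`, and good reduction asks `v_p(Δ(C • W)) = 0`
(Silverman AEC VII.5.1). So `IsOrdinaryAt W p → W.IsElliptic`; dropping the binder changes nothing.
[folklore] -/
theorem isElliptic_of_isOrdinaryAt (W : WeierstrassCurve ℚ) [W.IsGloballyMinimal] (p : ℕ)
    [Fact p.Prime] (h : IsOrdinaryAt W p) : W.IsElliptic := by
  have hv := h.1.goodReduction
  rw [WeierstrassCurve.minimal, WeierstrassCurve.variableChange_Δ] at hv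
  refine ⟨isUnit_iff_ne_zero.mpr fun hΔ => ?_⟩
  have h0 : (W.baseChange ℚ_[p]).Δ = 0 := by
    simp [WeierstrassCurve.baseChange, WeierstrassCurve.map_Δ, hΔ]
  rw [h0, mul_zero, map_zero] at hv
  exact zero_ne_one hv

end LoadBearing

/-! ## §3 The `p = 2` instance of the construction is the standard one -/

section TwoAdic

/-- `e₀(2) = 2`: `Γ = 1 + 4ℤ₂`. [folklore] -/
theorem cyclotomicExponent_two : cyclotomicExponent 2 = 2 := by
  simp [cyclotomicExponent]

/-- `γ = 5` at `p = 2` (topological generator of `1 + 4ℤ₂`; MTT86 §I.13). [folklore] -/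
theorem cyclotomicGenerator_two : cyclotomicGenerator 2 = 5 := by
  simp [cyclotomicGenerator, cyclotomicExponent]

/-- The torsion of `ℤ₂^×` used by the Riemann sums is `{±1}` (order `φ(4) = 2`). [folklore] -/
theorem torsionOrder_two : torsionOrder 2 = 2 := by
  simp only [torsionOrder, cyclotomicExponent, if_true]
  decide

/-- For odd `p`: `e₀ = 1`, `γ = 1 + p`, torsion order `p - 1`. [folklore] -/
theorem torsionOrder_odd {p : ℕ} [hp : Fact p.Prime] (h2 : p ≠ 2) : torsionOrder p = p - 1 := by
  simp [torsionOrder, cyclotomicExponent, h2, Nat.totient_prime hp.out]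

end TwoAdic

/-! ## §4 Line `Sketch`: the open stubs are weakenings of the crux -/

section LineSketch

/-- **Exactness of the decomposition** (`Lines/Sketch.lean`): the three OPEN stubs S3 (`3 ≤ r_an →
r_an ≤ ord`), S4 (`r_an = 1 → ord ≤ 1`), S5 (`2 ≤ r_an → ord ≤ r_an`) are literal consequences of the
crux, so none can be refuted without refuting the crux; with S1/S2 LANDED
(`stub_constantCoeff_eq_zero_iff`, `stub_even_order_iff_even_analyticRank`) the line is an exact
partition: crux ⇔ S3 ∧ S4 ∧ S5. [folklore] -/
theorem stubs_of_crux (h : PAdicOrderComparisonR2) :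
    (∀ (W : WeierstrassCurve ℚ) [W.IsElliptic] [W.IsGloballyMinimal] (p : ℕ) [Fact p.Prime],
      IsOrdinaryAt W p → ∀ {N : ℕ} [NeZero N] (f : CuspForm (Gamma0 N) 2), IsNewformOf W f →
        3 ≤ W.analyticRank →
          (W.analyticRank : ℕ∞) ≤ (padicLFunction f (unitRoot W p : ℚ_[p])).order) ∧
    (∀ (W : WeierstrassCurve ℚ) [W.IsElliptic] [W.IsGloballyMinimal] (p : ℕ) [Fact p.Prime],
      IsOrdinaryAt W p → ∀ {N : ℕ} [NeZero N] (f : CuspForm (Gamma0 N) 2), IsNewformOf W f →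
        W.analyticRank = 1 → (padicLFunction f (unitRoot W p : ℚ_[p])).order ≤ 1) ∧
    (∀ (W : WeierstrassCurve ℚ) [W.IsElliptic] [W.IsGloballyMinimal] (p : ℕ) [Fact p.Prime],
      IsOrdinaryAt W p → ∀ {N : ℕ} [NeZero N] (f : CuspForm (Gamma0 N) 2), IsNewformOf W f →
        2 ≤ W.analyticRank →
          (padicLFunction f (unitRoot W p : ℚ_[p])).order ≤ W.analyticRank) := by
  refine ⟨fun W _ _ p _ hord N _ f hf _ => (h W p hord f hf).ge,
    fun W _ _ p _ hord N _ f hf h1 => ?_, fun W _ _ p _ hord N _ f hf _ => (h W p hord f hf).le⟩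
  rw [h W p hord f hf, h1, Nat.cast_one]

end LineSketch

end Summit.BirchSwinnertonDyer.BirchSwinnertonDyer.Cruxes.PAdicOrderComparisonR2.Disproof
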